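import Literature.Analysis.Calculus.SeeleyExtension
import Literature.Analysis.FluidPDE.WeakSolution
import HarnessLib

/-!
# Extension of slab-smooth data to space–time test fields (topic `Analysis/PDE`)

Analytic layer of the programme to prove short-time existence for quasilinear strictly
parabolic systems on a closed manifold (hypothesis `hQL` of
`Literature.Geometry.Riemannian.ricciFlow_shortTime_existence_of_quasilinear`). The heat
machinery of that programme (`heatDuhamelZero`, `HeatZeroInitialDuhamel.lean`) takes space–time
TEST FIELDS on all of `ℝ × E` as data, whereas the data produced by the iteration are only
given, and smooth (in Mathlib's within sense), on the closed time slab `[0, T] × E`, with compact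
spatial support. This file supplies the extension step:

* `slabExtend T Φ` — for `Φ : ℝ → E → W` and `T > 0`, the glued field
  `ψ₁(t/T) E Φ(t, x) + (1 - ψ₁(t/T)) E Φʳ(T - t, x)`, where `E` is Seeley's extension operator
  across `t = 0` (`Calculus/SeeleyExtension.lean`, `Literature.Analysis.Calculus.Seeley.extend`),
  `Φʳ(s) = Φ(T - s)` is the time-reflected field (so the second term extends across `t = T`),
  and `ψ₁ = smoothTransition (2 - 3s)` (`= 1` for `s ≤ 1/3`, `= 0` for `s ≥ 2/3`);
* `slabExtend_eq_of_mem`: `slabExtend T Φ t = Φ t` for `t ∈ [0, T]`;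
* `contDiff_uncurry_slabExtend`: if `uncurry Φ` is `C^∞` on `[0, T] ×ˢ univ` (within), then
  `uncurry (slabExtend T Φ)` is `C^∞` on `ℝ × E` (Seeley's theorem at both ends; each glued piece
  is smooth where its extension is, and vanishes identically on a neighbourhood of the rest);
* `slabExtend_eq_zero_of_notMem`, `slabExtend_eq_zero_of_le`, `slabExtend_eq_zero_of_ge`: the
  spatial support is that of `Φ`, the time support lies in `[-T/2, 3T/2]` (Seeley's cutoffs);
* `isSpaceTimeTestOn_slabExtend`: hence, for `Φ` with uniform compact spatial support,
  `slabExtend T Φ` is a space–time test field on `ℝ × E` agreeing with `Φ` on `[0, T]`.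

Linearity of the operator is not needed downstream and not recorded.

## References

* R. T. Seeley, *Extension of `C^∞` functions defined in a half space*, Proc. Amer. Math. Soc.
  15 (1964), 625–626, Theorem. [Seeley1964]
* L. Hörmander, *The Analysis of Linear Partial Differential Operators I*, 2nd ed., Springer
  1990, Thm. 1.4.1 (partitions of unity) and §2.3 (gluing of local extensions).
-/

noncomputable section

open Set Function Filter Topology TopologicalSpace
open scoped ContDiff Topology

namespace Literature.Analysis.PDE

open Literature.Analysis.Calculus Literature.Analysis.FluidPDE

variable {E : Type*} [NormedAddCommGroup E] [NormedSpace ℝ E]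
variable {W : Type*} [NormedAddCommGroup W] [NormedSpace ℝ W]

/-! ### The glue weight -/

/-- The glue weight `ψ₁(s) = smoothTransition (2 - 3s)`: smooth, `= 1` for `s ≤ 1/3`, `= 0` for
`s ≥ 2/3`. [folklore] -/
def glueWeight (s : ℝ) : ℝ := Real.smoothTransition (2 - 3 * s)

/-- The glue weight is smooth. [folklore] -/
theorem contDiff_glueWeight {n : ℕ∞} : ContDiff ℝ n glueWeight :=
  Real.smoothTransition.contDiff.comp (contDiff_const.sub (contDiff_const.mul contDiff_id))

/-- `ψ₁(s) = 1` for `s ≤ 1/3`. [folklore] -/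
theorem glueWeight_eq_one {s : ℝ} (hs : s ≤ 1 / 3) : glueWeight s = 1 :=
  Real.smoothTransition.one_of_one_le (by linarith)

/-- `ψ₁(s) = 0` for `s ≥ 2/3`. [folklore] -/
theorem glueWeight_eq_zero {s : ℝ} (hs : 2 / 3 ≤ s) : glueWeight s = 0 :=
  Real.smoothTransition.zero_of_nonpos (by linarith)

/-! ### Vanishing properties of Seeley's extension -/

section Seeley

variable {δ : ℝ} {f : ℝ × E → W}

/-- Seeley's extension vanishes at `(t, x)` if `f(·, x) ≡ 0` (the extension acts fibrewise in
`x`). [cite: Seeley1964, Theorem] -/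
theorem Seeley.extend_eq_zero_of_forall (δ : ℝ) {x : E} (h : ∀ s, f (s, x) = 0) (t : ℝ) :
    Seeley.extend δ f (t, x) = 0 := by
  unfold Seeley.extend
  split_ifs with ht
  · exact h t
  · have h0 : ∀ k, Seeley.term δ f k (t, x) = 0 := fun k ↦ by
      simp [Seeley.term, Seeley.scale_apply, h]
    simp [h0]

/-- Seeley's extension vanishes for `t ≤ -δ/2` (`δ > 0`): all cutoff weights vanish there.
[cite: Seeley1964, Theorem] -/
theorem Seeley.extend_eq_zero_of_le (hδ : 0 < δ) {t : ℝ} (ht : t ≤ -δ / 2) (x : E) :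
    Seeley.extend δ f (t, x) = 0 := by
  have ht0 : t < 0 := by linarith
  rw [Seeley.extend_of_neg (by exact ht0)]
  have h0 : ∀ k, Seeley.term δ f k (t, x) = 0 := fun k ↦ by
    have hw : Seeley.weight δ k t = 0 := by
      refine Seeley.weight_eq_zero ?_
      have h2k : (1 : ℝ) ≤ 2 ^ k := one_le_pow₀ (by norm_num)
      have h1 : 2 ^ k * t ≤ t := by nlinarith
      rw [div_le_iff₀ hδ]
      linarith
    simp [Seeley.term, hw]
  simp [h0]

end Seeley

/-! ### The glued extension operator -/

/-- **The slab extension**: for `Φ : ℝ → E → W` (given on `[0, T]`) and `T > 0`,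
`slabExtend T Φ (t, x) = ψ₁(t/T) EΦ(t, x) + (1 - ψ₁(t/T)) EΦʳ(T - t, x)` with Seeley's extension
`E` across `t = 0`, the reflected field `Φʳ(s) = Φ(T - s)`, and the glue weight `ψ₁`.
[cite: Seeley1964, Theorem] -/
def slabExtend (T : ℝ) (Φ : ℝ → E → W) (t : ℝ) (x : E) : W :=
  glueWeight (t / T) • Seeley.extend T (uncurry Φ) (t, x) +
    (1 - glueWeight (t / T)) • Seeley.extend T (uncurry fun s y ↦ Φ (T - s) y) (T - t, x)

variable {T : ℝ} {Φ : ℝ → E → W}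

/-- **The extension agrees with the data on `[0, T]`.** [cite: Seeley1964, Theorem] -/
theorem slabExtend_apply_of_mem {t : ℝ} (ht : t ∈ Icc 0 T) (x : E) :
    slabExtend T Φ t x = Φ t x := by
  rw [slabExtend, Seeley.extend_of_nonneg (by exact ht.1),
    Seeley.extend_of_nonneg (by simp only; linarith [ht.2])]
  simp only [uncurry_apply_pair, sub_sub_cancel]
  rw [← add_smul, add_sub_cancel, one_smul]

/-- Function form: `slabExtend T Φ t = Φ t` for `t ∈ [0, T]`. [cite: Seeley1964, Theorem] -/
theorem slabExtend_eq_of_mem {t : ℝ} (ht : t ∈ Icc 0 T) : slabExtend T Φ t = Φ t :=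
  funext fun x ↦ slabExtend_apply_of_mem ht x

/-- **Spatial support**: the extension vanishes at `(t, x)` whenever `Φ(·)(x) ≡ 0`. [folklore] -/
theorem slabExtend_eq_zero_of_forall {x : E} (h : ∀ s, Φ s x = 0) (t : ℝ) :
    slabExtend T Φ t x = 0 := by
  rw [slabExtend, Seeley.extend_eq_zero_of_forall T (fun s ↦ by exact h s),
    Seeley.extend_eq_zero_of_forall T (fun s ↦ by exact h (T - s))]
  simp

/-- **Time support, below**: the extension vanishes for `t ≤ -T/2`. [folklore] -/
theorem slabExtend_eq_zero_of_le (hT : 0 < T) {t : ℝ} (ht : t ≤ -T / 2) (x : E) :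
    slabExtend T Φ t x = 0 := by
  have h1 : glueWeight (t / T) = 1 := by
    refine glueWeight_eq_one ?_
    rw [div_le_iff₀ hT]
    linarith
  rw [slabExtend, h1, Seeley.extend_eq_zero_of_le hT ht x]
  simp

/-- **Time support, above**: the extension vanishes for `t ≥ 3T/2`. [folklore] -/
theorem slabExtend_eq_zero_of_ge (hT : 0 < T) {t : ℝ} (ht : 3 * T / 2 ≤ t) (x : E) :
    slabExtend T Φ t x = 0 := by
  have h0 : glueWeight (t / T) = 0 := by
    refine glueWeight_eq_zero ?_
    rw [le_div_iff₀ hT]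
    linarith
  rw [slabExtend, h0, Seeley.extend_eq_zero_of_le hT (t := T - t) (by linarith) x]
  simp

/-! ### Smoothness -/

section Smooth

variable [CompleteSpace W]

omit [CompleteSpace W] in
/-- The reflected field is smooth within the slab. [folklore] -/
theorem contDiffOn_uncurry_reflect (hΦ : ContDiffOn ℝ ∞ (uncurry Φ) (Icc 0 T ×ˢ univ)) :
    ContDiffOn ℝ ∞ (uncurry fun s y ↦ Φ (T - s) y) (Icc 0 T ×ˢ univ) := by
  have hr : ContDiff ℝ ∞ fun p : ℝ × E ↦ ((T - p.1, p.2) : ℝ × E) :=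
    (contDiff_const.sub contDiff_fst).prodMk contDiff_snd
  have hmaps : MapsTo (fun p : ℝ × E ↦ ((T - p.1, p.2) : ℝ × E)) (Icc 0 T ×ˢ univ) (Icc 0 T ×ˢ univ) := by
    intro p hp
    have h := (mem_prod.1 hp).1
    exact mem_prod.2 ⟨⟨by linarith [h.2], by linarith [h.1]⟩, mem_univ _⟩
  exact hΦ.comp hr.contDiffOn hmaps

omit [CompleteSpace W] in
/-- Smoothness of a glued piece: if `g` is `C^∞` on an open set `U` and the scalar weight `w` is
smooth and vanishes on an open set `V` with `U ∪ V = univ`, then `p ↦ w p • g p` is `C^∞`.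
[folklore] -/
theorem contDiff_smul_of_open_cover {U V : Set (ℝ × E)} (hU : IsOpen U) (hV : IsOpen V)
    (hUV : U ∪ V = univ) {w : ℝ × E → ℝ} (hw : ContDiff ℝ ∞ w) (hwV : ∀ p ∈ V, w p = 0)
    {g : ℝ × E → W} (hg : ContDiffOn ℝ ∞ g U) : ContDiff ℝ ∞ fun p ↦ w p • g p := by
  refine contDiff_iff_contDiffAt.2 fun p ↦ ?_
  have hp : p ∈ U ∪ V := by rw [hUV]; exact mem_univ p
  rcases hp with hpU | hpV
  · exact hw.contDiffAt.smul (hg.contDiffAt (hU.mem_nhds hpU))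
  · have heq : (fun q ↦ w q • g q) =ᶠ[𝓝 p] fun _ ↦ 0 := by
      filter_upwards [hV.mem_nhds hpV] with q hq
      rw [hwV q hq, zero_smul]
    exact (contDiffAt_const.congr_of_eventuallyEq heq)

/-- **Smoothness of the slab extension**: if `uncurry Φ` is `C^∞` on `[0, T] ×ˢ univ` in the
within sense and `T > 0`, then `uncurry (slabExtend T Φ)` is `C^∞` on `ℝ × E` (Seeley's theorem
across `t = 0` and, after reflection, across `t = T`; each glued piece vanishes identically near
the points where its extension is not known to be smooth). [cite: Seeley1964, Theorem] -/
theorem contDiff_uncurry_slabExtend (hT : 0 < T) (hΦ : ContDiffOn ℝ ∞ (uncurry Φ) (Icc 0 T ×ˢ univ)) :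
    ContDiff ℝ ∞ (uncurry (slabExtend T Φ)) := by
  -- Seeley at `t = 0` for `Φ` and for the reflected field
  have hslab : Seeley.slab T (univ : Set E) ⊆ Icc 0 T ×ˢ univ :=
    prod_mono Ico_subset_Icc_self le_rfl
  have h1 : ContDiffOn ℝ ∞ (Seeley.extend T (uncurry Φ)) (Iio T ×ˢ univ) :=
    Seeley.contDiffOn_extend hT isOpen_univ (hΦ.mono hslab)
  have h2 : ContDiffOn ℝ ∞ (Seeley.extend T (uncurry fun s y ↦ Φ (T - s) y)) (Iio T ×ˢ univ) :=
    Seeley.contDiffOn_extend hT isOpen_univ ((contDiffOn_uncurry_reflect hΦ).mono hslab)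
  -- the weight as a function on `ℝ × E`
  have hw : ContDiff ℝ ∞ fun p : ℝ × E ↦ glueWeight (p.1 / T) :=
    contDiff_glueWeight.comp (contDiff_fst.div_const T)
  -- piece 1: `ψ₁(t/T) • EΦ(t, x)` — smooth on `{t < T}`, zero on `{t > 2T/3}`
  have hP1 : ContDiff ℝ ∞ fun p : ℝ × E ↦ glueWeight (p.1 / T) • Seeley.extend T (uncurry Φ) p := by
    refine contDiff_smul_of_open_cover (U := Iio T ×ˢ univ) (V := {p : ℝ × E | 2 * T / 3 < p.1})
      (isOpen_Iio.prod isOpen_univ) (isOpen_lt continuous_const continuous_fst) ?_ hw ?_ h1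
    · ext p
      simp only [mem_union, mem_prod, mem_Iio, mem_univ, and_true, mem_setOf_eq, iff_true]
      by_cases h : p.1 < T
      · exact Or.inl h
      · right; linarith [not_lt.1 h]
    · intro p hp
      refine glueWeight_eq_zero ?_
      rw [le_div_iff₀ hT]
      have := hp.out
      linarith
  -- piece 2: `(1 - ψ₁(t/T)) • EΦʳ(T - t, x)` — smooth on `{t > 0}`, zero on `{t < T/3}`
  have hr : ContDiff ℝ ∞ fun p : ℝ × E ↦ ((T - p.1, p.2) : ℝ × E) :=
    (contDiff_const.sub contDiff_fst).prodMk contDiff_snd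
  have h2' : ContDiffOn ℝ ∞ (fun p : ℝ × E ↦ Seeley.extend T (uncurry fun s y ↦ Φ (T - s) y) (T - p.1, p.2))
      (Ioi 0 ×ˢ univ) := by
    have hmaps : MapsTo (fun p : ℝ × E ↦ ((T - p.1, p.2) : ℝ × E)) (Ioi 0 ×ˢ univ) (Iio T ×ˢ univ) := by
      intro p hp
      have h := (mem_prod.1 hp).1
      exact mem_prod.2 ⟨by simp only [mem_Iio]; linarith [mem_Ioi.1 h], mem_univ _⟩
    exact h2.comp hr.contDiffOn hmaps
  have hP2 : ContDiff ℝ ∞ fun p : ℝ × E ↦ (1 - glueWeight (p.1 / T)) •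
      Seeley.extend T (uncurry fun s y ↦ Φ (T - s) y) (T - p.1, p.2) := by
    refine contDiff_smul_of_open_cover (U := Ioi 0 ×ˢ univ) (V := {p : ℝ × E | p.1 < T / 3})
      (isOpen_Ioi.prod isOpen_univ) (isOpen_lt continuous_fst continuous_const) ?_
      (contDiff_const.sub hw) ?_ h2'
    · ext p
      simp only [mem_union, mem_prod, mem_Ioi, mem_univ, and_true, mem_setOf_eq, iff_true]
      by_cases h : 0 < p.1
      · exact Or.inl h
      · right; linarith [not_lt.1 h]
    · intro p hp
      have h1' : glueWeight (p.1 / T) = 1 := by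
        refine glueWeight_eq_one ?_
        rw [div_le_iff₀ hT]
        have := hp.out
        linarith
      rw [h1', sub_self]
  have heq : uncurry (slabExtend T Φ) = fun p : ℝ × E ↦
      glueWeight (p.1 / T) • Seeley.extend T (uncurry Φ) p +
        (1 - glueWeight (p.1 / T)) • Seeley.extend T (uncurry fun s y ↦ Φ (T - s) y) (T - p.1, p.2) := by
    funext p
    rfl
  rw [heq]
  exact hP1.add hP2

/-- **The slab extension is a space–time test field** agreeing with the data on `[0, T]`: if
`T > 0`, `uncurry Φ` is `C^∞` on `[0, T] ×ˢ univ` (within), and the slices of `Φ` vanish off a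
fixed compact set `K`, then `slabExtend T Φ` is a space–time test field on all of `ℝ × E`.
[cite: Seeley1964, Theorem] -/
theorem isSpaceTimeTestOn_slabExtend (hT : 0 < T) (hΦ : ContDiffOn ℝ ∞ (uncurry Φ) (Icc 0 T ×ˢ univ))
    {K : Set E} (hK : IsCompact K) (hΦK : ∀ s, ∀ x ∉ K, Φ s x = 0) :
    IsSpaceTimeTestOn (⊤ : Opens (ℝ × E)) (slabExtend T Φ) := by
  refine ⟨contDiff_uncurry_slabExtend hT hΦ, ?_, fun _ _ ↦ trivial⟩
  refine HasCompactSupport.intro ((isCompact_Icc (a := -T) (b := 2 * T)).prod hK) ?_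
  rintro ⟨t, x⟩ hp
  simp only [uncurry_apply_pair]
  by_cases hx : x ∈ K
  · have ht : t ∉ Icc (-T) (2 * T) := fun h ↦ hp (mem_prod.2 ⟨h, hx⟩)
    rcases lt_or_ge t (-T) with h | h
    · exact slabExtend_eq_zero_of_le hT (by linarith) x
    · have h2 : 2 * T < t := lt_of_not_ge fun h' ↦ ht ⟨h, h'⟩
      exact slabExtend_eq_zero_of_ge hT (by linarith) x
  · exact slabExtend_eq_zero_of_forall (fun s ↦ hΦK s x hx) t

end Smooth

end Literature.Analysis.PDE

end
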